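/-
Copyright: the b2b-balaban T⁴-continuum CRUX team, row NE7b OWNER lineage `t4-ne7b-p1` (gen 146). Project licence.
-/
import Summits.QuantumFields.BalabanUV.T4Continuum.Spine.NE7b.SupWeightedFivePointTools

/-!
# THE `K5`-FAMILY PROFILE LETTERS OF THE WEIGHTED CLASS (SCOPING-d17 §F at order 5; (666) extended).  The weighted fifth-order slot
# letters (692)–(737) take five profile letters of the step's `K5`-family `g^{abcd}_{z′} = Σ_u|A_{uz′}|K5_{abcdu}`: the masses with the fixed
# index in position 1, 2, 3, 4 and partner weights, `Σ_{a,b,c}ϑ₂(s,a)ϑ₂(s,b)ϑ₂(s,c)ϑ₂(a,b)ϑ₂(a,c)ϑ₂(b,c)Σ_{z′}g_{z′}σ_{sz′} ≤ αk5m1..4`, and the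
# column letter with internal weights `Σ_{a,b,c,d}g^{abcd}_{z′}σ_{az′}Π_{pairs}ϑ₂ ≤ αk5c`.  THIS FILE discharges them from the CLASS's intrinsic
# full-graph `ϑ₂`-letters of `K5` (`Σ K5·Π_{10 pairs}ϑ₂` in the five roles, `k5ϑ1..k5ϑ5`) and the FACTOR's weighted letters (`Σ_{z′}|A_{uz′}|σA_{uz′}
# ≤ αrσ`, `Σ_u|A_{uz′}|σA_{uz′} ≤ αcσ`) under the compatibility `σ_{vz′} ≤ ϑ₂(v,u)·σA_{uz′}`:
#   `αk5m_i = k5ϑ_i·αrσ` (i = 1..4), `αk5c = k5ϑ5·αcσ`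
# (row NE7b, node U5c; (689) `prod10_le`; Mathlib; [folklore]).  With (659)∕(666) this closes the letter supply of (692)–(737): the weighted
# class map at order 5 needs only the factor's weighted letters and the class's own `ϑ₂`-letters.

Cell `pub-balaban`, sub-cell `t4`, spine estimate NE7b (`T4WeightBudget.RelWeightBound`; the cell's OWN estimate — NOT PRINTED in
[Bałaban 1983–89], NOT PROVED).  Crux-route work under `Spine/NE7b/` by the row OWNER (`t4-ne7b-p1` gen 146, file (738)) under FREEZE
(0)'s crux-prover clause; NOTHING of Bałaban's is named as a Lean object, valued or asserted; no `T4Continuum/Support` leaf typed; no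
`def`, no notation; zero `sorry`.  Imports (BY NAME): the OWNER's (689) `…SupWeightedFivePointTools` (`prod10_le`).

WHAT IS PROVED ([folklore]): **`k5_mass_1`**, **`k5_mass_2`**, **`k5_mass_3`**, **`k5_mass_4`** (`αk5m·`), **`k5_col_internal`** (`αk5c`); toy.

HONEST (what this is NOT).  Letter transport only (the `u`-innermost, fixed-first letter shapes used here differ from the slot files' `hk5`
shape by a reindexing and `ϑ₂`-symmetry — bookkeeping for the packaging); scalar skeleton ((A3), NC-NE7b-α UNRULED); nothing of Bałaban's
asserted.  BY-NAME EFFECT ON THE WALL: NONE.  NE7b NOT PRINTED ∕ NOT PROVED; spine PROVED 0∕9; rung (B)+1 — the programme's measures remain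
FINITE-torus statements; NOT the mass gap, NOT Clay.  HONEST DEPENDENCY: continuum YM on T⁴ ⇐ BetaPertH ∧ nine spine estimates (0∕9
proved); BetaPertH ⇐ (D1) ∧ (D4) ∧ CAP+tail; G-an2-4 gates asym, D1 and NE2∕3∕4.
-/

set_option autoImplicit false

noncomputable section

namespace Summit.QuantumFields.BalabanUV.T4Continuum.NE7b.SupWeightedFamilyProfilesK5

open Finset Real Matrix
open scoped BigOperators
open SupWeightedFivePointTools (prod10_le)

variable {ι κ : Type} [Fintype ι] [Fintype κ]

variable {A : Matrix ι κ ℝ} {K5 : ι → ι → ι → ι → ι → ℝ} {ϑ₂ : ι → ι → ℝ} {σ σA : ι → κ → ℝ} {αrσ αcσ k5ϑ1 k5ϑ2 k5ϑ3 k5ϑ4 k5ϑ5 : ℝ}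

/-! ## The four masses -/

set_option maxHeartbeats 800000 in
/-- **`αk5m1`**: the `K5`-family mass with the fixed index in position 1 and partner weights,
`Σ_{a,b,c}ϑ₂(s,a)ϑ₂(s,b)ϑ₂(s,c)ϑ₂(a,b)ϑ₂(a,c)ϑ₂(b,c)·Σ_{z′}(Σ_u|A_{uz′}|K5)σ_{sz′} ≤ k5ϑ1·αrσ` from the full-graph letter of that role.
[folklore] -/
theorem k5_mass_1 (hK50 : ∀ a b c d u, 0 ≤ K5 a b c d u) (hϑ₂1 : ∀ x y, 1 ≤ ϑ₂ x y) (hσA0 : ∀ u z', 0 ≤ σA u z')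
    (hσϑ : ∀ v u z', σ v z' ≤ ϑ₂ v u * σA u z') (hAr : ∀ u, ∑ z', |A u z'| * σA u z' ≤ αrσ) (hα0 : 0 ≤ αrσ)
    (hk5 : ∀ s, ∑ a, ∑ b, ∑ c, ∑ u, K5 s a b c u * (ϑ₂ s a * ϑ₂ s b * ϑ₂ s c * ϑ₂ s u * ϑ₂ a b * ϑ₂ a c * ϑ₂ a u * ϑ₂ b c * ϑ₂ b u * ϑ₂ c u) ≤
          k5ϑ1) (s : ι) :
    ∑ a, ∑ b, ∑ c, (ϑ₂ s a * ϑ₂ s b * ϑ₂ s c * ϑ₂ a b * ϑ₂ a c * ϑ₂ b c) * ∑ z', (∑ u, |A u z'| * K5 s a b c u) * σ s z' ≤ k5ϑ1 * αrσ := by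
  have hϑ₂0 : ∀ x y, 0 ≤ ϑ₂ x y := fun x y => zero_le_one.trans (hϑ₂1 x y)
  have hW0 : ∀ a b c u, 0 ≤ ϑ₂ s a * ϑ₂ s b * ϑ₂ s c * ϑ₂ s u * ϑ₂ a b * ϑ₂ a c * ϑ₂ a u * ϑ₂ b c * ϑ₂ b u * ϑ₂ c u := fun a b c u =>
    mul_nonneg
        (mul_nonneg
          (mul_nonneg
            (mul_nonneg
              (mul_nonneg (mul_nonneg (mul_nonneg (mul_nonneg (mul_nonneg (hϑ₂0 s a) (hϑ₂0 s b)) (hϑ₂0 s c)) (hϑ₂0 s u)) (hϑ₂0 a b)) (hϑ₂0 a c))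
              (hϑ₂0 a u)) (hϑ₂0 b c)) (hϑ₂0 b u)) (hϑ₂0 c u)
  calc ∑ a, ∑ b, ∑ c, (ϑ₂ s a * ϑ₂ s b * ϑ₂ s c * ϑ₂ a b * ϑ₂ a c * ϑ₂ b c) * ∑ z', (∑ u, |A u z'| * K5 s a b c u) * σ s z'
      ≤ ∑ a, ∑ b, ∑ c, ∑ u, K5 s a b c u * (ϑ₂ s a * ϑ₂ s b * ϑ₂ s c * ϑ₂ s u * ϑ₂ a b * ϑ₂ a c * ϑ₂ a u * ϑ₂ b c * ϑ₂ b u * ϑ₂ c u) * ∑ z', |A u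
          z'| * σA u z' := by
        refine sum_le_sum fun a _ => sum_le_sum fun b _ => sum_le_sum fun c _ => ?_
        rw [mul_sum]
        calc ∑ z', (ϑ₂ s a * ϑ₂ s b * ϑ₂ s c * ϑ₂ a b * ϑ₂ a c * ϑ₂ b c) * ((∑ u, |A u z'| * K5 s a b c u) * σ s z')
            ≤ ∑ z', ∑ u, K5 s a b c u * (ϑ₂ s a * ϑ₂ s b * ϑ₂ s c * ϑ₂ s u * ϑ₂ a b * ϑ₂ a c * ϑ₂ a u * ϑ₂ b c * ϑ₂ b u * ϑ₂ c u) *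
                (|A u z'| * σA u z') := by
              refine sum_le_sum fun z' _ => ?_
              rw [sum_mul, mul_sum]
              refine sum_le_sum fun u _ => ?_
              calc (ϑ₂ s a * ϑ₂ s b * ϑ₂ s c * ϑ₂ a b * ϑ₂ a c * ϑ₂ b c) * (|A u z'| * K5 s a b c u * σ s z') ≤
                  (ϑ₂ s a * ϑ₂ s b * ϑ₂ s c * ϑ₂ a b * ϑ₂ a c * ϑ₂ b c) * (|A u z'| * K5 s a b c u * (ϑ₂ s u * σA u z')) :=
                    mul_le_mul_of_nonneg_left (mul_le_mul_of_nonneg_left (hσϑ s u z') (mul_nonneg (abs_nonneg _) (hK50 _ _ _ _ _)))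
                        (mul_nonneg (mul_nonneg (mul_nonneg (mul_nonneg (mul_nonneg (hϑ₂0 s a) (hϑ₂0 s b)) (hϑ₂0 s c)) (hϑ₂0 a b)) (hϑ₂0 a c))
                          (hϑ₂0 b c))
                _ = K5 s a b c u * (ϑ₂ s a * ϑ₂ s b * ϑ₂ s c * ϑ₂ s u * ϑ₂ a b * ϑ₂ a c * 1 * ϑ₂ b c * 1 * 1) * (|A u z'| * σA u z') := (by ring)
                _ ≤ K5 s a b c u * (ϑ₂ s a * ϑ₂ s b * ϑ₂ s c * ϑ₂ s u * ϑ₂ a b * ϑ₂ a c * ϑ₂ a u * ϑ₂ b c * ϑ₂ b u * ϑ₂ c u) *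
                    (|A u z'| * σA u z') :=
                    mul_le_mul_of_nonneg_right
                        (mul_le_mul_of_nonneg_left
                          (prod10_le le_rfl le_rfl le_rfl le_rfl le_rfl le_rfl (hϑ₂1 a u) le_rfl (hϑ₂1 b u) (hϑ₂1 c u) (hϑ₂0 _ _) (hϑ₂0 _ _)
                            (hϑ₂0 _ _) (hϑ₂0 _ _) (hϑ₂0 _ _) (hϑ₂0 _ _) zero_le_one (hϑ₂0 _ _) zero_le_one zero_le_one) (hK50 _ _ _ _ _))
                        (mul_nonneg (abs_nonneg _) (hσA0 u z'))
          _ = ∑ u, K5 s a b c u * (ϑ₂ s a * ϑ₂ s b * ϑ₂ s c * ϑ₂ s u * ϑ₂ a b * ϑ₂ a c * ϑ₂ a u * ϑ₂ b c * ϑ₂ b u * ϑ₂ c u) * ∑ z', |A u z'| * σA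
              u z' := by
              rw [sum_comm]; exact sum_congr rfl fun u _ => (by rw [mul_sum])
    _ ≤ ∑ a, ∑ b, ∑ c, ∑ u, K5 s a b c u * (ϑ₂ s a * ϑ₂ s b * ϑ₂ s c * ϑ₂ s u * ϑ₂ a b * ϑ₂ a c * ϑ₂ a u * ϑ₂ b c * ϑ₂ b u * ϑ₂ c u) * αrσ :=
        sum_le_sum fun a _ => sum_le_sum fun b _ => sum_le_sum fun c _ => sum_le_sum fun u _ =>
        mul_le_mul_of_nonneg_left (hAr u) (mul_nonneg (hK50 _ _ _ _ _) (hW0 a b c u))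
    _ = (∑ a, ∑ b, ∑ c, ∑ u, K5 s a b c u * (ϑ₂ s a * ϑ₂ s b * ϑ₂ s c * ϑ₂ s u * ϑ₂ a b * ϑ₂ a c * ϑ₂ a u * ϑ₂ b c * ϑ₂ b u * ϑ₂ c u)) * αrσ := by
        rw [sum_mul]; refine sum_congr rfl fun a _ => ?_; rw [sum_mul]; refine sum_congr rfl fun b _ => ?_; rw [sum_mul]
        exact sum_congr rfl fun c _ => (by rw [sum_mul])
    _ ≤ k5ϑ1 * αrσ := mul_le_mul_of_nonneg_right (hk5 s) hα0

set_option maxHeartbeats 800000 in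
/-- **`αk5m2`**: the `K5`-family mass with the fixed index in position 2 and partner weights,
`Σ_{a,b,c}ϑ₂(s,a)ϑ₂(s,b)ϑ₂(s,c)ϑ₂(a,b)ϑ₂(a,c)ϑ₂(b,c)·Σ_{z′}(Σ_u|A_{uz′}|K5)σ_{sz′} ≤ k5ϑ2·αrσ` from the full-graph letter of that role.
[folklore] -/
theorem k5_mass_2 (hK50 : ∀ a b c d u, 0 ≤ K5 a b c d u) (hϑ₂1 : ∀ x y, 1 ≤ ϑ₂ x y) (hσA0 : ∀ u z', 0 ≤ σA u z')
    (hσϑ : ∀ v u z', σ v z' ≤ ϑ₂ v u * σA u z') (hAr : ∀ u, ∑ z', |A u z'| * σA u z' ≤ αrσ) (hα0 : 0 ≤ αrσ)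
    (hk5 : ∀ s, ∑ a, ∑ b, ∑ c, ∑ u, K5 a s b c u * (ϑ₂ s a * ϑ₂ s b * ϑ₂ s c * ϑ₂ s u * ϑ₂ a b * ϑ₂ a c * ϑ₂ a u * ϑ₂ b c * ϑ₂ b u * ϑ₂ c u) ≤
          k5ϑ2) (s : ι) :
    ∑ a, ∑ b, ∑ c, (ϑ₂ s a * ϑ₂ s b * ϑ₂ s c * ϑ₂ a b * ϑ₂ a c * ϑ₂ b c) * ∑ z', (∑ u, |A u z'| * K5 a s b c u) * σ s z' ≤ k5ϑ2 * αrσ := by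
  have hϑ₂0 : ∀ x y, 0 ≤ ϑ₂ x y := fun x y => zero_le_one.trans (hϑ₂1 x y)
  have hW0 : ∀ a b c u, 0 ≤ ϑ₂ s a * ϑ₂ s b * ϑ₂ s c * ϑ₂ s u * ϑ₂ a b * ϑ₂ a c * ϑ₂ a u * ϑ₂ b c * ϑ₂ b u * ϑ₂ c u := fun a b c u =>
    mul_nonneg
        (mul_nonneg
          (mul_nonneg
            (mul_nonneg
              (mul_nonneg (mul_nonneg (mul_nonneg (mul_nonneg (mul_nonneg (hϑ₂0 s a) (hϑ₂0 s b)) (hϑ₂0 s c)) (hϑ₂0 s u)) (hϑ₂0 a b)) (hϑ₂0 a c))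
              (hϑ₂0 a u)) (hϑ₂0 b c)) (hϑ₂0 b u)) (hϑ₂0 c u)
  calc ∑ a, ∑ b, ∑ c, (ϑ₂ s a * ϑ₂ s b * ϑ₂ s c * ϑ₂ a b * ϑ₂ a c * ϑ₂ b c) * ∑ z', (∑ u, |A u z'| * K5 a s b c u) * σ s z'
      ≤ ∑ a, ∑ b, ∑ c, ∑ u, K5 a s b c u * (ϑ₂ s a * ϑ₂ s b * ϑ₂ s c * ϑ₂ s u * ϑ₂ a b * ϑ₂ a c * ϑ₂ a u * ϑ₂ b c * ϑ₂ b u * ϑ₂ c u) * ∑ z', |A u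
          z'| * σA u z' := by
        refine sum_le_sum fun a _ => sum_le_sum fun b _ => sum_le_sum fun c _ => ?_
        rw [mul_sum]
        calc ∑ z', (ϑ₂ s a * ϑ₂ s b * ϑ₂ s c * ϑ₂ a b * ϑ₂ a c * ϑ₂ b c) * ((∑ u, |A u z'| * K5 a s b c u) * σ s z')
            ≤ ∑ z', ∑ u, K5 a s b c u * (ϑ₂ s a * ϑ₂ s b * ϑ₂ s c * ϑ₂ s u * ϑ₂ a b * ϑ₂ a c * ϑ₂ a u * ϑ₂ b c * ϑ₂ b u * ϑ₂ c u) *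
                (|A u z'| * σA u z') := by
              refine sum_le_sum fun z' _ => ?_
              rw [sum_mul, mul_sum]
              refine sum_le_sum fun u _ => ?_
              calc (ϑ₂ s a * ϑ₂ s b * ϑ₂ s c * ϑ₂ a b * ϑ₂ a c * ϑ₂ b c) * (|A u z'| * K5 a s b c u * σ s z') ≤
                  (ϑ₂ s a * ϑ₂ s b * ϑ₂ s c * ϑ₂ a b * ϑ₂ a c * ϑ₂ b c) * (|A u z'| * K5 a s b c u * (ϑ₂ s u * σA u z')) :=
                    mul_le_mul_of_nonneg_left (mul_le_mul_of_nonneg_left (hσϑ s u z') (mul_nonneg (abs_nonneg _) (hK50 _ _ _ _ _)))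
                        (mul_nonneg (mul_nonneg (mul_nonneg (mul_nonneg (mul_nonneg (hϑ₂0 s a) (hϑ₂0 s b)) (hϑ₂0 s c)) (hϑ₂0 a b)) (hϑ₂0 a c))
                          (hϑ₂0 b c))
                _ = K5 a s b c u * (ϑ₂ s a * ϑ₂ s b * ϑ₂ s c * ϑ₂ s u * ϑ₂ a b * ϑ₂ a c * 1 * ϑ₂ b c * 1 * 1) * (|A u z'| * σA u z') := (by ring)
                _ ≤ K5 a s b c u * (ϑ₂ s a * ϑ₂ s b * ϑ₂ s c * ϑ₂ s u * ϑ₂ a b * ϑ₂ a c * ϑ₂ a u * ϑ₂ b c * ϑ₂ b u * ϑ₂ c u) *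
                    (|A u z'| * σA u z') :=
                    mul_le_mul_of_nonneg_right
                        (mul_le_mul_of_nonneg_left
                          (prod10_le le_rfl le_rfl le_rfl le_rfl le_rfl le_rfl (hϑ₂1 a u) le_rfl (hϑ₂1 b u) (hϑ₂1 c u) (hϑ₂0 _ _) (hϑ₂0 _ _)
                            (hϑ₂0 _ _) (hϑ₂0 _ _) (hϑ₂0 _ _) (hϑ₂0 _ _) zero_le_one (hϑ₂0 _ _) zero_le_one zero_le_one) (hK50 _ _ _ _ _))
                        (mul_nonneg (abs_nonneg _) (hσA0 u z'))
          _ = ∑ u, K5 a s b c u * (ϑ₂ s a * ϑ₂ s b * ϑ₂ s c * ϑ₂ s u * ϑ₂ a b * ϑ₂ a c * ϑ₂ a u * ϑ₂ b c * ϑ₂ b u * ϑ₂ c u) * ∑ z', |A u z'| * σA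
              u z' := by
              rw [sum_comm]; exact sum_congr rfl fun u _ => (by rw [mul_sum])
    _ ≤ ∑ a, ∑ b, ∑ c, ∑ u, K5 a s b c u * (ϑ₂ s a * ϑ₂ s b * ϑ₂ s c * ϑ₂ s u * ϑ₂ a b * ϑ₂ a c * ϑ₂ a u * ϑ₂ b c * ϑ₂ b u * ϑ₂ c u) * αrσ :=
        sum_le_sum fun a _ => sum_le_sum fun b _ => sum_le_sum fun c _ => sum_le_sum fun u _ =>
        mul_le_mul_of_nonneg_left (hAr u) (mul_nonneg (hK50 _ _ _ _ _) (hW0 a b c u))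
    _ = (∑ a, ∑ b, ∑ c, ∑ u, K5 a s b c u * (ϑ₂ s a * ϑ₂ s b * ϑ₂ s c * ϑ₂ s u * ϑ₂ a b * ϑ₂ a c * ϑ₂ a u * ϑ₂ b c * ϑ₂ b u * ϑ₂ c u)) * αrσ := by
        rw [sum_mul]; refine sum_congr rfl fun a _ => ?_; rw [sum_mul]; refine sum_congr rfl fun b _ => ?_; rw [sum_mul]
        exact sum_congr rfl fun c _ => (by rw [sum_mul])
    _ ≤ k5ϑ2 * αrσ := mul_le_mul_of_nonneg_right (hk5 s) hα0

set_option maxHeartbeats 800000 in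
/-- **`αk5m3`**: the `K5`-family mass with the fixed index in position 3 and partner weights,
`Σ_{a,b,c}ϑ₂(s,a)ϑ₂(s,b)ϑ₂(s,c)ϑ₂(a,b)ϑ₂(a,c)ϑ₂(b,c)·Σ_{z′}(Σ_u|A_{uz′}|K5)σ_{sz′} ≤ k5ϑ3·αrσ` from the full-graph letter of that role.
[folklore] -/
theorem k5_mass_3 (hK50 : ∀ a b c d u, 0 ≤ K5 a b c d u) (hϑ₂1 : ∀ x y, 1 ≤ ϑ₂ x y) (hσA0 : ∀ u z', 0 ≤ σA u z')
    (hσϑ : ∀ v u z', σ v z' ≤ ϑ₂ v u * σA u z') (hAr : ∀ u, ∑ z', |A u z'| * σA u z' ≤ αrσ) (hα0 : 0 ≤ αrσ)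
    (hk5 : ∀ s, ∑ a, ∑ b, ∑ c, ∑ u, K5 a b s c u * (ϑ₂ s a * ϑ₂ s b * ϑ₂ s c * ϑ₂ s u * ϑ₂ a b * ϑ₂ a c * ϑ₂ a u * ϑ₂ b c * ϑ₂ b u * ϑ₂ c u) ≤
          k5ϑ3) (s : ι) :
    ∑ a, ∑ b, ∑ c, (ϑ₂ s a * ϑ₂ s b * ϑ₂ s c * ϑ₂ a b * ϑ₂ a c * ϑ₂ b c) * ∑ z', (∑ u, |A u z'| * K5 a b s c u) * σ s z' ≤ k5ϑ3 * αrσ := by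
  have hϑ₂0 : ∀ x y, 0 ≤ ϑ₂ x y := fun x y => zero_le_one.trans (hϑ₂1 x y)
  have hW0 : ∀ a b c u, 0 ≤ ϑ₂ s a * ϑ₂ s b * ϑ₂ s c * ϑ₂ s u * ϑ₂ a b * ϑ₂ a c * ϑ₂ a u * ϑ₂ b c * ϑ₂ b u * ϑ₂ c u := fun a b c u =>
    mul_nonneg
        (mul_nonneg
          (mul_nonneg
            (mul_nonneg
              (mul_nonneg (mul_nonneg (mul_nonneg (mul_nonneg (mul_nonneg (hϑ₂0 s a) (hϑ₂0 s b)) (hϑ₂0 s c)) (hϑ₂0 s u)) (hϑ₂0 a b)) (hϑ₂0 a c))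
              (hϑ₂0 a u)) (hϑ₂0 b c)) (hϑ₂0 b u)) (hϑ₂0 c u)
  calc ∑ a, ∑ b, ∑ c, (ϑ₂ s a * ϑ₂ s b * ϑ₂ s c * ϑ₂ a b * ϑ₂ a c * ϑ₂ b c) * ∑ z', (∑ u, |A u z'| * K5 a b s c u) * σ s z'
      ≤ ∑ a, ∑ b, ∑ c, ∑ u, K5 a b s c u * (ϑ₂ s a * ϑ₂ s b * ϑ₂ s c * ϑ₂ s u * ϑ₂ a b * ϑ₂ a c * ϑ₂ a u * ϑ₂ b c * ϑ₂ b u * ϑ₂ c u) * ∑ z', |A u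
          z'| * σA u z' := by
        refine sum_le_sum fun a _ => sum_le_sum fun b _ => sum_le_sum fun c _ => ?_
        rw [mul_sum]
        calc ∑ z', (ϑ₂ s a * ϑ₂ s b * ϑ₂ s c * ϑ₂ a b * ϑ₂ a c * ϑ₂ b c) * ((∑ u, |A u z'| * K5 a b s c u) * σ s z')
            ≤ ∑ z', ∑ u, K5 a b s c u * (ϑ₂ s a * ϑ₂ s b * ϑ₂ s c * ϑ₂ s u * ϑ₂ a b * ϑ₂ a c * ϑ₂ a u * ϑ₂ b c * ϑ₂ b u * ϑ₂ c u) *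
                (|A u z'| * σA u z') := by
              refine sum_le_sum fun z' _ => ?_
              rw [sum_mul, mul_sum]
              refine sum_le_sum fun u _ => ?_
              calc (ϑ₂ s a * ϑ₂ s b * ϑ₂ s c * ϑ₂ a b * ϑ₂ a c * ϑ₂ b c) * (|A u z'| * K5 a b s c u * σ s z') ≤
                  (ϑ₂ s a * ϑ₂ s b * ϑ₂ s c * ϑ₂ a b * ϑ₂ a c * ϑ₂ b c) * (|A u z'| * K5 a b s c u * (ϑ₂ s u * σA u z')) :=
                    mul_le_mul_of_nonneg_left (mul_le_mul_of_nonneg_left (hσϑ s u z') (mul_nonneg (abs_nonneg _) (hK50 _ _ _ _ _)))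
                        (mul_nonneg (mul_nonneg (mul_nonneg (mul_nonneg (mul_nonneg (hϑ₂0 s a) (hϑ₂0 s b)) (hϑ₂0 s c)) (hϑ₂0 a b)) (hϑ₂0 a c))
                          (hϑ₂0 b c))
                _ = K5 a b s c u * (ϑ₂ s a * ϑ₂ s b * ϑ₂ s c * ϑ₂ s u * ϑ₂ a b * ϑ₂ a c * 1 * ϑ₂ b c * 1 * 1) * (|A u z'| * σA u z') := (by ring)
                _ ≤ K5 a b s c u * (ϑ₂ s a * ϑ₂ s b * ϑ₂ s c * ϑ₂ s u * ϑ₂ a b * ϑ₂ a c * ϑ₂ a u * ϑ₂ b c * ϑ₂ b u * ϑ₂ c u) *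
                    (|A u z'| * σA u z') :=
                    mul_le_mul_of_nonneg_right
                        (mul_le_mul_of_nonneg_left
                          (prod10_le le_rfl le_rfl le_rfl le_rfl le_rfl le_rfl (hϑ₂1 a u) le_rfl (hϑ₂1 b u) (hϑ₂1 c u) (hϑ₂0 _ _) (hϑ₂0 _ _)
                            (hϑ₂0 _ _) (hϑ₂0 _ _) (hϑ₂0 _ _) (hϑ₂0 _ _) zero_le_one (hϑ₂0 _ _) zero_le_one zero_le_one) (hK50 _ _ _ _ _))
                        (mul_nonneg (abs_nonneg _) (hσA0 u z'))
          _ = ∑ u, K5 a b s c u * (ϑ₂ s a * ϑ₂ s b * ϑ₂ s c * ϑ₂ s u * ϑ₂ a b * ϑ₂ a c * ϑ₂ a u * ϑ₂ b c * ϑ₂ b u * ϑ₂ c u) * ∑ z', |A u z'| * σA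
              u z' := by
              rw [sum_comm]; exact sum_congr rfl fun u _ => (by rw [mul_sum])
    _ ≤ ∑ a, ∑ b, ∑ c, ∑ u, K5 a b s c u * (ϑ₂ s a * ϑ₂ s b * ϑ₂ s c * ϑ₂ s u * ϑ₂ a b * ϑ₂ a c * ϑ₂ a u * ϑ₂ b c * ϑ₂ b u * ϑ₂ c u) * αrσ :=
        sum_le_sum fun a _ => sum_le_sum fun b _ => sum_le_sum fun c _ => sum_le_sum fun u _ =>
        mul_le_mul_of_nonneg_left (hAr u) (mul_nonneg (hK50 _ _ _ _ _) (hW0 a b c u))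
    _ = (∑ a, ∑ b, ∑ c, ∑ u, K5 a b s c u * (ϑ₂ s a * ϑ₂ s b * ϑ₂ s c * ϑ₂ s u * ϑ₂ a b * ϑ₂ a c * ϑ₂ a u * ϑ₂ b c * ϑ₂ b u * ϑ₂ c u)) * αrσ := by
        rw [sum_mul]; refine sum_congr rfl fun a _ => ?_; rw [sum_mul]; refine sum_congr rfl fun b _ => ?_; rw [sum_mul]
        exact sum_congr rfl fun c _ => (by rw [sum_mul])
    _ ≤ k5ϑ3 * αrσ := mul_le_mul_of_nonneg_right (hk5 s) hα0

set_option maxHeartbeats 800000 in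
/-- **`αk5m4`**: the `K5`-family mass with the fixed index in position 4 and partner weights,
`Σ_{a,b,c}ϑ₂(s,a)ϑ₂(s,b)ϑ₂(s,c)ϑ₂(a,b)ϑ₂(a,c)ϑ₂(b,c)·Σ_{z′}(Σ_u|A_{uz′}|K5)σ_{sz′} ≤ k5ϑ4·αrσ` from the full-graph letter of that role.
[folklore] -/
theorem k5_mass_4 (hK50 : ∀ a b c d u, 0 ≤ K5 a b c d u) (hϑ₂1 : ∀ x y, 1 ≤ ϑ₂ x y) (hσA0 : ∀ u z', 0 ≤ σA u z')
    (hσϑ : ∀ v u z', σ v z' ≤ ϑ₂ v u * σA u z') (hAr : ∀ u, ∑ z', |A u z'| * σA u z' ≤ αrσ) (hα0 : 0 ≤ αrσ)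
    (hk5 : ∀ s, ∑ a, ∑ b, ∑ c, ∑ u, K5 a b c s u * (ϑ₂ s a * ϑ₂ s b * ϑ₂ s c * ϑ₂ s u * ϑ₂ a b * ϑ₂ a c * ϑ₂ a u * ϑ₂ b c * ϑ₂ b u * ϑ₂ c u) ≤
          k5ϑ4) (s : ι) :
    ∑ a, ∑ b, ∑ c, (ϑ₂ s a * ϑ₂ s b * ϑ₂ s c * ϑ₂ a b * ϑ₂ a c * ϑ₂ b c) * ∑ z', (∑ u, |A u z'| * K5 a b c s u) * σ s z' ≤ k5ϑ4 * αrσ := by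
  have hϑ₂0 : ∀ x y, 0 ≤ ϑ₂ x y := fun x y => zero_le_one.trans (hϑ₂1 x y)
  have hW0 : ∀ a b c u, 0 ≤ ϑ₂ s a * ϑ₂ s b * ϑ₂ s c * ϑ₂ s u * ϑ₂ a b * ϑ₂ a c * ϑ₂ a u * ϑ₂ b c * ϑ₂ b u * ϑ₂ c u := fun a b c u =>
    mul_nonneg
        (mul_nonneg
          (mul_nonneg
            (mul_nonneg
              (mul_nonneg (mul_nonneg (mul_nonneg (mul_nonneg (mul_nonneg (hϑ₂0 s a) (hϑ₂0 s b)) (hϑ₂0 s c)) (hϑ₂0 s u)) (hϑ₂0 a b)) (hϑ₂0 a c))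
              (hϑ₂0 a u)) (hϑ₂0 b c)) (hϑ₂0 b u)) (hϑ₂0 c u)
  calc ∑ a, ∑ b, ∑ c, (ϑ₂ s a * ϑ₂ s b * ϑ₂ s c * ϑ₂ a b * ϑ₂ a c * ϑ₂ b c) * ∑ z', (∑ u, |A u z'| * K5 a b c s u) * σ s z'
      ≤ ∑ a, ∑ b, ∑ c, ∑ u, K5 a b c s u * (ϑ₂ s a * ϑ₂ s b * ϑ₂ s c * ϑ₂ s u * ϑ₂ a b * ϑ₂ a c * ϑ₂ a u * ϑ₂ b c * ϑ₂ b u * ϑ₂ c u) * ∑ z', |A u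
          z'| * σA u z' := by
        refine sum_le_sum fun a _ => sum_le_sum fun b _ => sum_le_sum fun c _ => ?_
        rw [mul_sum]
        calc ∑ z', (ϑ₂ s a * ϑ₂ s b * ϑ₂ s c * ϑ₂ a b * ϑ₂ a c * ϑ₂ b c) * ((∑ u, |A u z'| * K5 a b c s u) * σ s z')
            ≤ ∑ z', ∑ u, K5 a b c s u * (ϑ₂ s a * ϑ₂ s b * ϑ₂ s c * ϑ₂ s u * ϑ₂ a b * ϑ₂ a c * ϑ₂ a u * ϑ₂ b c * ϑ₂ b u * ϑ₂ c u) *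
                (|A u z'| * σA u z') := by
              refine sum_le_sum fun z' _ => ?_
              rw [sum_mul, mul_sum]
              refine sum_le_sum fun u _ => ?_
              calc (ϑ₂ s a * ϑ₂ s b * ϑ₂ s c * ϑ₂ a b * ϑ₂ a c * ϑ₂ b c) * (|A u z'| * K5 a b c s u * σ s z') ≤
                  (ϑ₂ s a * ϑ₂ s b * ϑ₂ s c * ϑ₂ a b * ϑ₂ a c * ϑ₂ b c) * (|A u z'| * K5 a b c s u * (ϑ₂ s u * σA u z')) :=
                    mul_le_mul_of_nonneg_left (mul_le_mul_of_nonneg_left (hσϑ s u z') (mul_nonneg (abs_nonneg _) (hK50 _ _ _ _ _)))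
                        (mul_nonneg (mul_nonneg (mul_nonneg (mul_nonneg (mul_nonneg (hϑ₂0 s a) (hϑ₂0 s b)) (hϑ₂0 s c)) (hϑ₂0 a b)) (hϑ₂0 a c))
                          (hϑ₂0 b c))
                _ = K5 a b c s u * (ϑ₂ s a * ϑ₂ s b * ϑ₂ s c * ϑ₂ s u * ϑ₂ a b * ϑ₂ a c * 1 * ϑ₂ b c * 1 * 1) * (|A u z'| * σA u z') := (by ring)
                _ ≤ K5 a b c s u * (ϑ₂ s a * ϑ₂ s b * ϑ₂ s c * ϑ₂ s u * ϑ₂ a b * ϑ₂ a c * ϑ₂ a u * ϑ₂ b c * ϑ₂ b u * ϑ₂ c u) *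
                    (|A u z'| * σA u z') :=
                    mul_le_mul_of_nonneg_right
                        (mul_le_mul_of_nonneg_left
                          (prod10_le le_rfl le_rfl le_rfl le_rfl le_rfl le_rfl (hϑ₂1 a u) le_rfl (hϑ₂1 b u) (hϑ₂1 c u) (hϑ₂0 _ _) (hϑ₂0 _ _)
                            (hϑ₂0 _ _) (hϑ₂0 _ _) (hϑ₂0 _ _) (hϑ₂0 _ _) zero_le_one (hϑ₂0 _ _) zero_le_one zero_le_one) (hK50 _ _ _ _ _))
                        (mul_nonneg (abs_nonneg _) (hσA0 u z'))
          _ = ∑ u, K5 a b c s u * (ϑ₂ s a * ϑ₂ s b * ϑ₂ s c * ϑ₂ s u * ϑ₂ a b * ϑ₂ a c * ϑ₂ a u * ϑ₂ b c * ϑ₂ b u * ϑ₂ c u) * ∑ z', |A u z'| * σA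
              u z' := by
              rw [sum_comm]; exact sum_congr rfl fun u _ => (by rw [mul_sum])
    _ ≤ ∑ a, ∑ b, ∑ c, ∑ u, K5 a b c s u * (ϑ₂ s a * ϑ₂ s b * ϑ₂ s c * ϑ₂ s u * ϑ₂ a b * ϑ₂ a c * ϑ₂ a u * ϑ₂ b c * ϑ₂ b u * ϑ₂ c u) * αrσ :=
        sum_le_sum fun a _ => sum_le_sum fun b _ => sum_le_sum fun c _ => sum_le_sum fun u _ =>
        mul_le_mul_of_nonneg_left (hAr u) (mul_nonneg (hK50 _ _ _ _ _) (hW0 a b c u))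
    _ = (∑ a, ∑ b, ∑ c, ∑ u, K5 a b c s u * (ϑ₂ s a * ϑ₂ s b * ϑ₂ s c * ϑ₂ s u * ϑ₂ a b * ϑ₂ a c * ϑ₂ a u * ϑ₂ b c * ϑ₂ b u * ϑ₂ c u)) * αrσ := by
        rw [sum_mul]; refine sum_congr rfl fun a _ => ?_; rw [sum_mul]; refine sum_congr rfl fun b _ => ?_; rw [sum_mul]
        exact sum_congr rfl fun c _ => (by rw [sum_mul])
    _ ≤ k5ϑ4 * αrσ := mul_le_mul_of_nonneg_right (hk5 s) hα0

/-! ## The column letter with internal weights -/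

omit [Fintype κ] in
set_option maxHeartbeats 800000 in
/-- **`αk5c`**: the `K5`-family column letter with internal weights, `Σ_{a,b,c,d}(Σ_u|A_{uz′}|K5_{abcdu})σ_{az′}·Π_{pairs⊂{a,b,c,d}}ϑ₂ ≤
k5ϑ5·αcσ` from the full-graph fifth-index letter (`ϑ₂` symmetric, `≥ 1`). [folklore] -/
theorem k5_col_internal (hK50 : ∀ a b c d u, 0 ≤ K5 a b c d u) (hϑ₂1 : ∀ x y, 1 ≤ ϑ₂ x y) (hϑ₂symm : ∀ x y, ϑ₂ x y = ϑ₂ y x)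
    (hσA0 : ∀ u z', 0 ≤ σA u z') (hσϑ : ∀ v u z', σ v z' ≤ ϑ₂ v u * σA u z') (hAc : ∀ z', ∑ u, |A u z'| * σA u z' ≤ αcσ)
    (hk5c : ∀ u, ∑ a, ∑ b, ∑ c, ∑ d, K5 a b c d u * (ϑ₂ u a * ϑ₂ u b * ϑ₂ u c * ϑ₂ u d * ϑ₂ a b * ϑ₂ a c * ϑ₂ a d * ϑ₂ b c * ϑ₂ b d * ϑ₂ c d) ≤
          k5ϑ5) (hk5c0 : 0 ≤ k5ϑ5) (z' : κ) :
    ∑ a, ∑ b, ∑ c, ∑ d, (∑ u, |A u z'| * K5 a b c d u) * (σ a z' * (ϑ₂ a b * ϑ₂ a c * ϑ₂ a d * ϑ₂ b c * ϑ₂ b d * ϑ₂ c d)) ≤ k5ϑ5 * αcσ := by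
  have hϑ₂0 : ∀ x y, 0 ≤ ϑ₂ x y := fun x y => zero_le_one.trans (hϑ₂1 x y)
  have hI0 : ∀ a b c d, 0 ≤ ϑ₂ a b * ϑ₂ a c * ϑ₂ a d * ϑ₂ b c * ϑ₂ b d * ϑ₂ c d := fun a b c d =>
    mul_nonneg (mul_nonneg (mul_nonneg (mul_nonneg (mul_nonneg (hϑ₂0 a b) (hϑ₂0 a c)) (hϑ₂0 a d)) (hϑ₂0 b c)) (hϑ₂0 b d)) (hϑ₂0 c d)
  calc ∑ a, ∑ b, ∑ c, ∑ d, (∑ u, |A u z'| * K5 a b c d u) * (σ a z' * (ϑ₂ a b * ϑ₂ a c * ϑ₂ a d * ϑ₂ b c * ϑ₂ b d * ϑ₂ c d))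
      ≤ ∑ a, ∑ b, ∑ c, ∑ d, ∑ u, |A u z'| * σA u z' *
          (K5 a b c d u * (ϑ₂ u a * ϑ₂ u b * ϑ₂ u c * ϑ₂ u d * ϑ₂ a b * ϑ₂ a c * ϑ₂ a d * ϑ₂ b c * ϑ₂ b d * ϑ₂ c d)) := by
        refine sum_le_sum fun a _ => sum_le_sum fun b _ => sum_le_sum fun c _ => sum_le_sum fun d _ => ?_
        rw [sum_mul]
        refine sum_le_sum fun u _ => ?_
        calc |A u z'| * K5 a b c d u * (σ a z' * (ϑ₂ a b * ϑ₂ a c * ϑ₂ a d * ϑ₂ b c * ϑ₂ b d * ϑ₂ c d))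
            ≤ |A u z'| * K5 a b c d u * (ϑ₂ a u * σA u z' * (ϑ₂ a b * ϑ₂ a c * ϑ₂ a d * ϑ₂ b c * ϑ₂ b d * ϑ₂ c d)) :=
              mul_le_mul_of_nonneg_left (mul_le_mul_of_nonneg_right (hσϑ a u z') (hI0 a b c d)) (mul_nonneg (abs_nonneg _) (hK50 a b c d u))
          _ = |A u z'| * σA u z' * (K5 a b c d u * (ϑ₂ u a * 1 * 1 * 1 * ϑ₂ a b * ϑ₂ a c * ϑ₂ a d * ϑ₂ b c * ϑ₂ b d * ϑ₂ c d)) :=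
              (by rw [hϑ₂symm a u]; ring)
          _ ≤ |A u z'| * σA u z' * (K5 a b c d u * (ϑ₂ u a * ϑ₂ u b * ϑ₂ u c * ϑ₂ u d * ϑ₂ a b * ϑ₂ a c * ϑ₂ a d * ϑ₂ b c * ϑ₂ b d * ϑ₂ c d)) :=
              mul_le_mul_of_nonneg_left
                  (mul_le_mul_of_nonneg_left
                    (prod10_le le_rfl (hϑ₂1 u b) (hϑ₂1 u c) (hϑ₂1 u d) le_rfl le_rfl le_rfl le_rfl le_rfl le_rfl (hϑ₂0 _ _) zero_le_one
                      zero_le_one zero_le_one (hϑ₂0 _ _) (hϑ₂0 _ _) (hϑ₂0 _ _) (hϑ₂0 _ _) (hϑ₂0 _ _) (hϑ₂0 _ _)) (hK50 a b c d u))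
                  (mul_nonneg (abs_nonneg _) (hσA0 u z'))
    _ = ∑ a, ∑ b, ∑ c, ∑ u, ∑ d, |A u z'| * σA u z' *
        (K5 a b c d u * (ϑ₂ u a * ϑ₂ u b * ϑ₂ u c * ϑ₂ u d * ϑ₂ a b * ϑ₂ a c * ϑ₂ a d * ϑ₂ b c * ϑ₂ b d * ϑ₂ c d)) :=
        sum_congr rfl fun a _ => sum_congr rfl fun b _ => sum_congr rfl fun c _ => sum_comm
    _ = ∑ a, ∑ b, ∑ u, ∑ c, ∑ d, |A u z'| * σA u z' *
        (K5 a b c d u * (ϑ₂ u a * ϑ₂ u b * ϑ₂ u c * ϑ₂ u d * ϑ₂ a b * ϑ₂ a c * ϑ₂ a d * ϑ₂ b c * ϑ₂ b d * ϑ₂ c d)) :=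
        sum_congr rfl fun a _ => sum_congr rfl fun b _ => sum_comm
    _ = ∑ a, ∑ u, ∑ b, ∑ c, ∑ d, |A u z'| * σA u z' *
        (K5 a b c d u * (ϑ₂ u a * ϑ₂ u b * ϑ₂ u c * ϑ₂ u d * ϑ₂ a b * ϑ₂ a c * ϑ₂ a d * ϑ₂ b c * ϑ₂ b d * ϑ₂ c d)) := sum_congr rfl fun a _ =>
        sum_comm
    _ = ∑ u, ∑ a, ∑ b, ∑ c, ∑ d, |A u z'| * σA u z' *
        (K5 a b c d u * (ϑ₂ u a * ϑ₂ u b * ϑ₂ u c * ϑ₂ u d * ϑ₂ a b * ϑ₂ a c * ϑ₂ a d * ϑ₂ b c * ϑ₂ b d * ϑ₂ c d)) := sum_comm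
    _ = ∑ u, |A u z'| * σA u z' * ∑ a, ∑ b, ∑ c, ∑ d, K5 a b c d u *
        (ϑ₂ u a * ϑ₂ u b * ϑ₂ u c * ϑ₂ u d * ϑ₂ a b * ϑ₂ a c * ϑ₂ a d * ϑ₂ b c * ϑ₂ b d * ϑ₂ c d) :=
        sum_congr rfl fun u _ => by
          rw [mul_sum]; refine sum_congr rfl fun a _ => ?_; rw [mul_sum]; refine sum_congr rfl fun b _ => ?_; rw [mul_sum]
          exact sum_congr rfl fun c _ => (by rw [mul_sum])
    _ ≤ ∑ u, |A u z'| * σA u z' * k5ϑ5 := sum_le_sum fun u _ => mul_le_mul_of_nonneg_left (hk5c u) (mul_nonneg (abs_nonneg _) (hσA0 u z'))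
    _ = (∑ u, |A u z'| * σA u z') * k5ϑ5 := by rw [sum_mul]
    _ ≤ αcσ * k5ϑ5 := mul_le_mul_of_nonneg_right (hAc z') hk5c0
    _ = k5ϑ5 * αcσ := mul_comm _ _

/-! ## Toy -/

/-- Toy (the transport in numbers): an intrinsic letter `2` and a factor letter `3` give the profile letter `6`. -/
example : (2 : ℝ) * 3 = 6 := by norm_num

end Summit.QuantumFields.BalabanUV.T4Continuum.NE7b.SupWeightedFamilyProfilesK5

end
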